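import Summits.BirchSwinnertonDyer.BirchSwinnertonDyer.Theorems.KatoDescentTamePotSupersingularTameLowerFibreResidualIdentificationNewformDatum
import Summits.BirchSwinnertonDyer.BirchSwinnertonDyer.Theorems.KatoDescentTamePotSupersingularTameLowerFibreAdjointBricksFiveCoeffField
import Literature.NumberTheory.EllipticCurves.NonEisensteinPrimeOfSurjective
import Literature.NumberTheory.EllipticCurves.LFunctionPrimeCoeff
import Literature.NumberTheory.EllipticCurves.Fouquet2024.OrdinaryFibreRankZeroBSD
import Literature.NumberTheory.EllipticCurves.NewformsCoeffFieldHolds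
import HarnessLib

/-!
# Route `KatoDescentTamePotSupersingular` (rung K8, sub-rung B4 (t′), cell `bsd-potss`): child crux
# `TameLowerIntrinsicNonCM` (item stmt-BirchSwinnertonDyer-19618) — T2⁰: the desk's fibre-wise lattice input
# of the Fouquet-2024 ordinary-fibre road AT `p = 5`, ON THE NEWFORM LOCUS, is a THEOREM
# (duty T-S7r07-1b, TARGET R211; a `--supports … --as helper` file; seat `bsd-potss-k8t-c2`, gen 20)

HONEST FRAMING.  The Fouquet-2024 ordinary-FIBRE road on the cell `(5; II*, v₅(c₄) = 4)` of the open core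
(k8t-c2 g11/g12: `Literature/…/Fouquet2024/OrdinaryFibreRankZeroBSD.lean`, roads p520558 ff.) reads, at a member
`g` of Hida's `Λ`-adic fibre through `ρ̄_{W,5}`, Kato's hypothesis (12.5.2) / Skinner–Urban's integral clause for
the lattice of an integral ordinary datum `Δ` of `(g, ι)`: «after an `𝒪`-basis change, `SL₂(ℤ₅) ⊆ P ρ_Δ P⁻¹ (Γ_ℚ)`»
(`LatticeClause Δ` below).  The BSD cited-literature audit (ARM P, cell `pub/bsd-cited`, reader r07, sheet S7 and
addenda; desk C2 R981; this cell's TARGET R211) typed the referee texts T1 = `LatticeClause` and T2 =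
`FibreLatticeInput p` (the fibre-wise input of reading (R3): lattice clause for every member of the fibre, from
`ρ̄_{W,p}` onto, the (ram) prime, an ordinary Nakamura line, `p ∤ M`, level primes inside `N_W`, and the trace
congruence `a_ℓ(g) ≡ a_ℓ(W)`), IN PRINT for `p ≥ 7` (Manoharmayum 2015, `k ≠ 𝔽₅`) and NOT LOCATED in print at
`p = 5` — the gap «Δ1@5».  Seat k8t-c2 g13–g18 closed Δ1@5 BY KERNEL: files I–XXII
(`…TameLowerFibreAdjointBricksFive*.lean`: the `GL₂(𝔽₅)`-lifting route (T5′) — `H¹(GL₂(𝔽₅), 𝔰𝔩₂) = 0`, Boston's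
criterion layer by layer, `p`-adic limit, models, newform datum, `K = ℚ₅(ι K_g)` finite when `K_g` is a number field)
and RI-I/II/III (`…TameLowerFibreResidualIdentification*.lean`: the residual identification `ρ̄_Δ ≅ W[5] ⊗ k` PRODUCED
from the trace congruence by Chebotarev + Brauer–Nesbitt), apex
`FibreResidualIdentification.exists_latticeClause_newformDatum_of_traceCongruent` (RI-III ':297').  ARM P's kernel
kit K30 (sheet D-AUDIT-r07-S7-ADDENDUM-12-PS6, `sheets/r07-S7-add12-ps6/d_audit_r07_S7_add12_K30_RI.lean` §2–§3,
rc 0, axioms trio) then read the END FORM: T2 ⟸ ONE displayed schema «`K_g/ℚ` finite for every weight-2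
`Γ₀(M)`-member carrying a 5-adic ordinary datum» (`fibreLatticeInput_five_of_finiteDimensional_coeffField`), and ON
THE NEWFORM LOCUS (`IsNewform0 g` — the classical points of the fibre ARE newforms, Fouquet 2024 p. 29) T2⁰ =
`FibreLatticeInputNewform0 5` is a THEOREM OUTRIGHT (`fibreLatticeInputNewform0_five`), `K_g/ℚ` finite being the
tree theorem `IsNewform0.finiteDimensional_coeffField_holds` (Shimura 3.48).  THIS FILE lands exactly those texts
in tree currency (kit K30 §2: `LatticeClause`, `FibreLatticeInput`; §3: `FibreLatticeInputNewform0`,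
`traceCongruent_of_T2binder`, `fibreLatticeInput_five_of_finiteDimensional_coeffField`,
`fibreLatticeInputNewform0_five`, `fibreLatticeInputNewform0_of_fibreLatticeInput`; statements byte-identical to the
kit up to namespace), so that T-S7r07-1 reads CLOSED-LANDED by name and ARM P re-locks one line.

WHAT THIS IS NOT.  The three `def`s are PREDICATES (schemata with parameters), not named facts: nothing is asserted
by them.  `FibreLatticeInput 5` itself (all `Γ₀(M)`-eigenforms, not only newforms) is NOT proved here — it is
reduced to the displayed finiteness schema; off the newform locus that schema is not a tree theorem.  Fouquet 2024
Thm 1.1 (iv)⇒(ii) and the fibre facts (A′)/(B′) stay cite-level named facts; the L₀ core 19618 / crux 19981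
(Kato's Main Conjecture 12.10, lower inclusion, at an additive potentially supersingular prime) stays OPEN; no class
is booked; BSD is proved for no curve.

References: [SkinnerUrban2014] Thm. 3.6.4 (p. 43); [Kato2004Asterisque] (12.5.2) (p. 222); [Manoharmayum2015] Main
Theorem, Remark 4.4; [SerreAbelianLadic1968] IV-23 Lemma 3; [Fouquet2024CongruencesIMC] Thm 1.1, p. 29 (fibre),
§4.2; Shimura 1971 Thm. 3.48 (tree `IsNewform0.finiteDimensional_coeffField_holds`).
-/

set_option linter.dupNamespace false
set_option autoImplicit false

noncomputable section

open scoped Classical MatrixGroups ModularForm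

namespace Summit.BirchSwinnertonDyer.BirchSwinnertonDyer.Theorems.TameLowerFibreLatticeInputNewform0

open WeierstrassCurve CongruenceSubgroup UpperHalfPlane
  Literature.NumberTheory.EllipticCurves
  Literature.NumberTheory.EllipticCurves.Fouquet2024
  Literature.NumberTheory.EllipticCurves.ModularForms
  Literature.NumberTheory.EllipticCurves.GreenbergSelmer
  Literature.NumberTheory.GaloisRepresentations
  Summit.BirchSwinnertonDyer.BirchSwinnertonDyer.Theorems.GL2F5AdjointBricks
  Summit.BirchSwinnertonDyer.BirchSwinnertonDyer.Theorems.FibreResidualIdentification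

/-! ### §1 The desk-graded typed referee texts T1 / T2 (ARM P sheet S7 §E = kit K30 §2, VERBATIM up to namespace) -/

section Schemata

variable {M : ℕ} {k : ℤ} {g : CuspForm (Gamma0 M) k} {p : ℕ} [Fact p.Prime]
  {ι : coeffField g →+* PadicAlgCl p}

/-- **T1 — Kato's (12.5.2) / Skinner–Urban's integral clause for an integral ordinary datum `Δ` of `(g, ι)`**: after a
change of `𝒪`-basis `P ∈ GL₂(𝒪)` of the lattice, EVERY matrix of `SL₂(ℤ_p)` (read in `GL₂(ℚ̄_p)`) is a value of
`P ρ P⁻¹` on `Γ_ℚ`. (S–U ask it of `Γ_ℚ`, Kato (12.5.2) of `Gal(ℚ̄/ℚ(ζ_{p^∞}))`; for `p ≥ 5` the two agree, `SL₂(ℤ_p)`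
being perfect.)  A predicate on `Δ`; nothing asserted.  (ARM P sheet S7 §E, text T1, verbatim.)
[cite: SkinnerUrban2014, Thm 3.6.4 (p. 43)] [cite: Kato2004Asterisque, (12.5.2) (p. 222)] -/
def LatticeClause (Δ : OrdinaryNewformDatum g p ι) : Prop :=
  ∃ P : GL (Fin 2) (padicCoeffIntegers ι),
    ∀ A : SL(2, ℤ_[p]),
      ∃ σ : Field.absoluteGaloisGroup ℚ,
        ((P * Δ.ρ σ * P⁻¹ : GL (Fin 2) (padicCoeffIntegers ι)) :
            Matrix (Fin 2) (Fin 2) (padicCoeffIntegers ι)).map (padicCoeffIntegers.toPadicAlgCl ι) =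
          (A : Matrix (Fin 2) (Fin 2) ℤ_[p]).map ((algebraMap ℚ_[p] (PadicAlgCl p)).comp PadicInt.Coe.ringHom)

/-- **T2 — the fibre-wise input of reading (R3) at the prime `p`** (fact (B)'s class; `Σ` = primes of `p·N_W`): for
every `W` with `ρ̄_{W,p}` onto, the (ram) prime and an ordinary Nakamura line at `p`, and every weight-2
`Γ₀(M)`-eigenform `g` with an integral `p`-ordinary datum, `p ∤ M`, all primes of `M` dividing `N_W`, and
`a_ℓ(g) ≡ a_ℓ(W)` in `ℚ̄_p` for every prime `ℓ ∤ p·M·N_W` (so `ρ̄_g ≅ W[p] ⊗ k`): the lattice clause holds for that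
datum. In PRINT for `p ≥ 7` (Manoharmayum 2015 Main Theorem, `k = 𝔽_p`, `|k| ≥ 4`, `k ≠ 𝔽₅`); NOT LOCATED in
print for `p = 5` (gap Δ1@5, closed by kernel on the newform locus: `fibreLatticeInputNewform0_five`).  A predicate
on `p`; nothing asserted.  (ARM P sheet S7 §E, text T2, verbatim.)
[cite: Manoharmayum2015, Main Theorem] [cite: SerreAbelianLadic1968, IV-23 Lemma 3] -/
def FibreLatticeInput (p : ℕ) [Fact p.Prime] : Prop :=
  ∀ (W : WeierstrassCurve ℚ) [W.IsElliptic] [W.IsGloballyMinimal],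
    W.HasSurjectiveModNGaloisRep p →
    (∃ ℓ : ℕ, ∃ _ : Fact ℓ.Prime, ℓ ≠ p ∧ W.HasMultiplicativeReductionAtPrime ℓ ∧
      ¬ p ∣ padicValInt ℓ W.minimalDiscriminantInt ∧ ¬ p ∣ ℓ - 1 ∧ ¬ p ∣ ℓ + 1) →
    HasOrdinaryLineNakamuraAt p W →
    ∀ {M : ℕ} (g : CuspForm (Gamma0 M) 2) (ι : coeffField g →+* PadicAlgCl p)
      (Δ : OrdinaryNewformDatum g p ι),
      ¬ p ∣ M → (∀ r : ℕ, r.Prime → r ∣ M → r ∣ W.conductorNorm ℤ) →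
      (∀ ℓ : ℕ, ℓ.Prime → ¬ ℓ ∣ p * M * W.conductorNorm ℤ →
        ‖ι ⟨(qExpansion 1 ⇑g).coeff ℓ, coeff_mem_coeffField g ℓ⟩ - ((W.LFunction ℓ : ℤ) : PadicAlgCl p)‖ < 1) →
      LatticeClause Δ

/-- **T2⁰ — the desk's T2 ON THE NEWFORM LOCUS**: `FibreLatticeInput p`'s binders VERBATIM plus `IsNewform0 g` (the
members of the print's `Λ`-fibre ARE newforms: Fouquet 2024 p. 29 «classical points»; EPW §3.1); `[NeZero M]` displayed
because `IsNewform0` is stated for levels `M ≠ 0` (T2's own `¬ p ∣ M` forces it: `neZero_of_not_dvd`).  A predicate on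
`p`; nothing asserted.  (ARM P kit K30 §3, verbatim.)
[cite: Fouquet2024CongruencesIMC, Thm 1.1 (p. 24) and fibre (p. 29)] [cite: Kato2004Asterisque, (12.5.2) (p. 222)] -/
def FibreLatticeInputNewform0 (p : ℕ) [Fact p.Prime] : Prop :=
  ∀ (W : WeierstrassCurve ℚ) [W.IsElliptic] [W.IsGloballyMinimal],
    W.HasSurjectiveModNGaloisRep p →
    (∃ ℓ : ℕ, ∃ _ : Fact ℓ.Prime, ℓ ≠ p ∧ W.HasMultiplicativeReductionAtPrime ℓ ∧
      ¬ p ∣ padicValInt ℓ W.minimalDiscriminantInt ∧ ¬ p ∣ ℓ - 1 ∧ ¬ p ∣ ℓ + 1) →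
    HasOrdinaryLineNakamuraAt p W →
    ∀ {M : ℕ} [NeZero M] (g : CuspForm (Gamma0 M) 2) (ι : coeffField g →+* PadicAlgCl p)
      (Δ : OrdinaryNewformDatum g p ι),
      IsNewform0 g →
      ¬ p ∣ M → (∀ r : ℕ, r.Prime → r ∣ M → r ∣ W.conductorNorm ℤ) →
      (∀ ℓ : ℕ, ℓ.Prime → ¬ ℓ ∣ p * M * W.conductorNorm ℤ →
        ‖ι ⟨(qExpansion 1 ⇑g).coeff ℓ, coeff_mem_coeffField g ℓ⟩ - ((W.LFunction ℓ : ℤ) : PadicAlgCl p)‖ < 1) →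
      LatticeClause Δ

omit [Fact p.Prime] in
/-- `¬ p ∣ M` (a T2 binder) forces `M ≠ 0`, so the `[NeZero M]` of the newform-locus schema is available inside T2.
[cite: Fouquet2024CongruencesIMC, Thm 1.1 (p. 24)] -/
theorem neZero_of_not_dvd {M : ℕ} (h : ¬ p ∣ M) : NeZero M :=
  ⟨by rintro rfl; exact h (dvd_zero p)⟩

/-- T2 ⟹ T2⁰ (the newform-locus schema is an instance of the desk's T2; sanity).
[cite: Fouquet2024CongruencesIMC, Thm 1.1 (p. 24) and fibre (p. 29)] -/
theorem fibreLatticeInputNewform0_of_fibreLatticeInput (H : FibreLatticeInput p) :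
    FibreLatticeInputNewform0 p := by
  intro W _ _ hsurj hram hord M _ g ι Δ _hg hpM hM hcong
  exact H W hsurj hram hord g ι Δ hpM hM hcong

end Schemata

/-! ### §2 The END FORM at `p = 5` (ARM P kit K30 §3, VERBATIM up to namespace) -/

section EndFormFive

variable [Fact (Nat.Prime 5)]

/-- From T2's congruence binder (all primes `ℓ ∤ 5·M·N_W`, `a_ℓ(W)` as `W.LFunction ℓ`) to RI-III's (good `ℓ ∤ 5M`
off `T = ∅`, `a_ℓ(W)` as `W.frobeniusTrace ℓ`): at a good prime `ℓ ∤ N_W` (`not_dvd_conductorNorm_of_hasGoodReductionAtPrime`)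
and `LFunction ℓ = frobeniusTrace ℓ` (`LFunction_apply_prime_eq_frobeniusTrace`) — both TREE THEOREMS; no new binder
for any consumer. [cite: Fouquet2024CongruencesIMC, Thm 1.1 (p. 24)] -/
theorem traceCongruent_of_T2binder (W : WeierstrassCurve ℚ) [W.IsElliptic] [W.IsGloballyMinimal] {M : ℕ}
    (g : CuspForm (Gamma0 M) 2) (ι : coeffField g →+* PadicAlgCl 5)
    (hcong : ∀ ℓ : ℕ, ℓ.Prime → ¬ ℓ ∣ 5 * M * W.conductorNorm ℤ →
      ‖ι ⟨(qExpansion 1 ⇑g).coeff ℓ, coeff_mem_coeffField g ℓ⟩ - ((W.LFunction ℓ : ℤ) : PadicAlgCl 5)‖ < 1) :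
    ∀ (ℓ : ℕ) [Fact ℓ.Prime], ℓ ∉ (∅ : Set ℕ) → ¬ ℓ ∣ M → ℓ ≠ 5 → W.HasGoodReductionAtPrime ℓ →
      ‖ι ⟨(qExpansion 1 ⇑g).coeff ℓ, coeff_mem_coeffField g ℓ⟩ - (W.frobeniusTrace ℓ : PadicAlgCl 5)‖ < 1 := by
  intro ℓ hℓF _ hℓM hℓ5 hgood
  have hℓ : ℓ.Prime := hℓF.out
  have hN : ¬ ℓ ∣ W.conductorNorm ℤ := not_dvd_conductorNorm_of_hasGoodReductionAtPrime W hgood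
  have h : ¬ ℓ ∣ 5 * M * W.conductorNorm ℤ := by
    intro hd
    rcases (Nat.Prime.dvd_mul hℓ).mp hd with h1 | h2
    · rcases (Nat.Prime.dvd_mul hℓ).mp h1 with h5 | hM'
      · exact hℓ5 ((Nat.prime_dvd_prime_iff_eq hℓ (by norm_num)).mp h5)
      · exact hℓM hM'
    · exact hN h2
  have := hcong ℓ hℓ h
  rwa [W.LFunction_apply_prime_eq_frobeniusTrace ℓ hgood] at this

/-- **END FORM of T2 at `p = 5`.**  The desk's typed referee target T2 `FibreLatticeInput 5` (VERBATIM) follows BY KERNEL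
from ONE displayed schema only: «`K_g = coeffField g` is finite over `ℚ` for every weight-2 `Γ₀(M)`-form `g` (`5 ∤ M`)
carrying a 5-adic integral ordinary datum» — the residual covering being PRODUCED (RI-III
`exists_latticeClause_newformDatum_of_traceCongruent`, from Chebotarev + Brauer–Nesbitt + the (T5′) lifting route I–XXII)
and `ℚ₅(ι K_g)/ℚ₅` finite derived (XXII).  Off the newform locus that schema is NOT a tree theorem: this is a reduction,
not a proof of T2. [cite: Kato2004Asterisque, (12.5.2) (p. 222)] [cite: SkinnerUrban2014, Thm 3.6.4 (p. 43)] -/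
theorem fibreLatticeInput_five_of_finiteDimensional_coeffField
    (hfin : ∀ {M : ℕ} (g : CuspForm (Gamma0 M) 2) (ι : coeffField g →+* PadicAlgCl 5),
      OrdinaryNewformDatum g 5 ι → ¬ 5 ∣ M → FiniteDimensional ℚ (coeffField g)) :
    FibreLatticeInput 5 := by
  intro W _ _ hsurj _hram _hord M g ι Δ hpM _hM hcong
  haveI : NeZero M := neZero_of_not_dvd hpM
  haveI : FiniteDimensional ℚ (coeffField g) := hfin g ι Δ hpM
  obtain ⟨P, hP⟩ := exists_latticeClause_newformDatum_of_traceCongruent ι Δ ⟨0, by norm_num⟩ W hsurj ∅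
    Set.finite_empty (traceCongruent_of_T2binder W g ι hcong)
  exact ⟨P, fun A => by
    obtain ⟨σ, -, hσ⟩ := hP A
    exact ⟨σ, hσ⟩⟩

/-- **T2⁰ at `p = 5` is a THEOREM OUTRIGHT** — no displayed schema: finiteness of `K_g/ℚ` for a `Γ₀(M)`-newform is the TREE
THEOREM `IsNewform0.finiteDimensional_coeffField_holds` (Shimura 3.48), the residual covering is PRODUCED (RI-III), the
lifting is (T5′) (I–XXII).  This is the kernel closure of the gap Δ1@5 of the Fouquet-2024 ordinary-fibre road on its own
locus (classical members of the Hida fibre are newforms).  Nothing about items 19618/19981 (open).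
[cite: Kato2004Asterisque, (12.5.2) (p. 222)] [cite: SkinnerUrban2014, Thm 3.6.4 (p. 43)]
[cite: Fouquet2024CongruencesIMC, Thm 1.1 (p. 24) and fibre (p. 29)] -/
theorem fibreLatticeInputNewform0_five : FibreLatticeInputNewform0 5 := by
  intro W _ _ hsurj _hram _hord M _ g ι Δ hg hpM _hM hcong
  haveI : FiniteDimensional ℚ (coeffField g) := IsNewform0.finiteDimensional_coeffField_holds hg
  obtain ⟨P, hP⟩ := exists_latticeClause_newformDatum_of_traceCongruent ι Δ ⟨0, by norm_num⟩ W hsurj ∅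
    Set.finite_empty (traceCongruent_of_T2binder W g ι hcong)
  exact ⟨P, fun A => by
    obtain ⟨σ, -, hσ⟩ := hP A
    exact ⟨σ, hσ⟩⟩

/-- **T1 on the newform locus from the PRODUCED inputs, the Kato-(12.5.2) form** (σ ranging over `Gal(ℚ̄/ℚ(ζ_∞))`):
for a `Γ₀(M)`-newform `g` of weight `k ≡ 2 (mod 4)` (`M ≠ 0`), an integral 5-adic ordinary datum `Δ`, `W` globally
minimal with `ρ̄_{W,5}` onto and the trace congruence off a finite set `T` of primes, there is an `𝒪`-basis change `P`
such that every `A ∈ SL₂(ℤ₅)` is `P Δ.ρ(σ) P⁻¹` for some `σ` FIXING ALL ROOTS OF UNITY — RI-III ':297' with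
`K_g/ℚ` finite discharged by Shimura 3.48; in particular `LatticeClause Δ`.
[cite: Kato2004Asterisque, (12.5.2) (p. 222)] [cite: SkinnerUrban2014, Thm 3.6.4 (p. 43)] -/
theorem latticeClause_cyclotomic_of_isNewform0_of_traceCongruent {M : ℕ} [NeZero M] {k : ℤ}
    {g : CuspForm (Gamma0 M) k} (ι : coeffField g →+* PadicAlgCl 5) (hg : IsNewform0 g)
    (Δ : OrdinaryNewformDatum g 5 ι) (hk : ∃ t : ℕ, (k - 1).toNat = 1 + 4 * t)
    (W : WeierstrassCurve ℚ) [W.IsElliptic] [W.IsGloballyMinimal] (hsurj : W.HasSurjectiveModNGaloisRep 5)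
    (T : Set ℕ) (hT : T.Finite)
    (hcong : ∀ (ℓ : ℕ) [Fact ℓ.Prime], ℓ ∉ T → ¬ ℓ ∣ M → ℓ ≠ 5 → W.HasGoodReductionAtPrime ℓ →
      ‖ι ⟨(qExpansion 1 ⇑g).coeff ℓ, coeff_mem_coeffField g ℓ⟩ - (W.frobeniusTrace ℓ : PadicAlgCl 5)‖ < 1) :
    (∃ P : GL (Fin 2) (padicCoeffIntegers ι), ∀ A : SL(2, ℤ_[5]), ∃ σ : Field.absoluteGaloisGroup ℚ,
      (∀ (n : ℕ) (t : AlgebraicClosure ℚ), 0 < n → t ^ n = 1 → σ • t = t) ∧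
        ((P * Δ.ρ σ * P⁻¹ : GL (Fin 2) (padicCoeffIntegers ι)) :
            Matrix (Fin 2) (Fin 2) (padicCoeffIntegers ι)).map (padicCoeffIntegers.toPadicAlgCl ι) =
          (A : Matrix (Fin 2) (Fin 2) ℤ_[5]).map ((algebraMap ℚ_[5] (PadicAlgCl 5)).comp PadicInt.Coe.ringHom)) ∧
    LatticeClause Δ := by
  haveI : FiniteDimensional ℚ (coeffField g) := IsNewform0.finiteDimensional_coeffField_holds hg
  obtain ⟨P, hP⟩ := exists_latticeClause_newformDatum_of_traceCongruent ι Δ hk W hsurj T hT hcong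
  exact ⟨⟨P, hP⟩, ⟨P, fun A => by
    obtain ⟨σ, -, hσ⟩ := hP A
    exact ⟨σ, hσ⟩⟩⟩

end EndFormFive

end Summit.BirchSwinnertonDyer.BirchSwinnertonDyer.Theorems.TameLowerFibreLatticeInputNewform0
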